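import Literature.Probability.Percolation.LonelyClusterExchange
import HarnessLib

/-!
# `NoHeavyLowerTail` (stmt-CriticalPhenomena-4575) — hull-port line: BHK transfers off the observer pair

Support file (prover `prim-hp-1`, hull-port / coupling line; `--supports stmt-CriticalPhenomena-4575`).  No definitions,
no named facts, no sorries.

Setting: bond percolation `μ = prodBernoulli w` on a finite vertex type, relays `A`, level `j`, `R_v = {|π(v)| ≤ j}`; an
OBSERVER PAIR `x, y` (in the crux: the two Steiner children of the observer, `U = C(x) ∪ C(y)`), a candidate witness `b` and a
comparison vertex `z` with `μ(R_z) ≤ μ(R_b)` ("`b` is at least as lonely-likely as `z`").  The open atom of the hull-port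
programme (crux evidence HULLPORT-COUPLING.md §8–§12) is the pair champion-stability inequality
`μ(b ∉ U, 1 ≤ |π(U)| ≤ j) ≤ μ(b ∉ U, R_b)` under such a hypothesis.  Van den Berg–Häggström–Kahn's Theorem 1.5, in the tree as
`LonelyClusterExchange.lonelyClusterTransfer_typeMinus`, says that `b` stays ahead of `z` on every event closed under
(shrinking `C_z`, enlarging `C_b`).  This file records the instances the programme uses:

* `HullPort.lonelier_transfer_compl` — bookkeeping form of the transfer: for `B` closed under (shrinking `C_z`, enlarging
  `C_b`) and `μ(R_z) ≤ μ(R_b)`: `μ(Bᶜ ∩ R_z) ≤ μ(Bᶜ ∩ R_b)` (on `{z ↔ b}` the two loneliness events coincide).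
* `HullPort.lonelier_transfer_offPair` — `E = {b ∉ U}`: `μ(b ∉ U, R_z) ≤ μ(b ∉ U, R_b)`.
* `HullPort.lonelier_transfer_offPair_swallowed` — `E = {b ∉ U, z ∈ U}`: `μ(b ∉ U, z ∈ U, R_z) ≤ μ(b ∉ U, z ∈ U, R_b)`.
* `HullPort.csPair_swallowed_part` — consequently the `z`-SWALLOWED part of the pair inequality holds:
  `μ(b ∉ U, z ∈ U, 1 ≤ |π(U)| ≤ j) ≤ μ(b ∉ U, z ∈ U, R_b)`; what remains open is the part `{z ∉ U}` (memo §11, statement (T*)).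
[cite: VandenbergHaggstromKahn2005, Thm. 1.5 (p. 7) — corollaries via the tree's `lonelyClusterTransfer_typeMinus`]
-/

noncomputable section

namespace Summit.CriticalPhenomena.PercolationContinuityZ3.Theorems

open MeasureTheory Set Literature.Probability.LatticeModels Literature.Probability.Percolation
open scoped Classical

variable {V : Type*}

namespace HullPort

open LonelyClusterExchange TwoClusterExchange

/-- **Transfer, complement form.**  Let `z ≠ b`, `μ(R_z) ≤ μ(R_b)`, and let `B` be closed under (shrinking `C_z`,
enlarging `C_b`).  Then `μ(Bᶜ ∩ R_z) ≤ μ(Bᶜ ∩ R_b)`: `b` stays at least as lonely-likely as `z` outside `B`.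
[cite: VandenbergHaggstromKahn2005, Thm. 1.5 (p. 7) — corollary] -/
theorem lonelier_transfer_compl [Fintype V] (w : Sym2 V → unitInterval) (A : Finset V) {z b : V}
    (hzb : z ≠ b) (j : ℕ) {B : Set (BondConfig V)}
    (hB : ∀ ⦃ω ω' : BondConfig V⦄, openEdgeCluster ω' z ⊆ openEdgeCluster ω z →
      openEdgeCluster ω b ⊆ openEdgeCluster ω' b → ω ∈ B → ω' ∈ B)
    (hle : (prodBernoulli w).real {ω : BondConfig V | (A.filter fun t => ω ∈ openConn z t).card ≤ j} ≤
      (prodBernoulli w).real {ω : BondConfig V | (A.filter fun t => ω ∈ openConn b t).card ≤ j}) :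
    (prodBernoulli w).real (Bᶜ ∩ {ω : BondConfig V | (A.filter fun t => ω ∈ openConn z t).card ≤ j}) ≤
      (prodBernoulli w).real (Bᶜ ∩ {ω : BondConfig V | (A.filter fun t => ω ∈ openConn b t).card ≤ j}) := by
  set μ := prodBernoulli w with hμ
  set Rz : Set (BondConfig V) := {ω | (A.filter fun t => ω ∈ openConn z t).card ≤ j} with hRz
  set Rb : Set (BondConfig V) := {ω | (A.filter fun t => ω ∈ openConn b t).card ≤ j} with hRb
  set D : Set (BondConfig V) := (openConn z b)ᶜ with hD
  have hmeas : ∀ S : Set (BondConfig V), MeasurableSet S := fun S => (Set.toFinite S).measurableSet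
  -- the transfer (BHK Thm 1.5): `μ(D ∩ (R_b ∩ B)) ≤ μ(D ∩ (B ∩ R_z)) + (μ R_b - μ R_z)`
  have hT : μ.real (D ∩ (Rb ∩ B)) ≤ μ.real (D ∩ (B ∩ Rz)) + (μ.real Rb - μ.real Rz) :=
    lonelyClusterTransfer_typeMinus w hzb A j hB hle
  -- on `{z ↔ b}` the loneliness events coincide
  have hDc : Rz \ D = Rb \ D := by
    ext ω
    simp only [hRz, hRb, hD, mem_sdiff, mem_compl_iff, not_not, mem_setOf_eq]
    constructor
    · rintro ⟨h, hzb'⟩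
      have h' : (openGraph ω).Reachable z b := hzb'
      have heq : (A.filter fun t => ω ∈ openConn z t) = (A.filter fun t => ω ∈ openConn b t) :=
        Finset.filter_congr fun t _ =>
          ⟨fun ht => (h'.symm.trans ht : (openGraph ω).Reachable b t),
            fun ht => (h'.trans ht : (openGraph ω).Reachable z t)⟩
      rw [heq] at h
      exact ⟨h, hzb'⟩
    · rintro ⟨h, hzb'⟩
      have h' : (openGraph ω).Reachable z b := hzb'
      have heq : (A.filter fun t => ω ∈ openConn b t) = (A.filter fun t => ω ∈ openConn z t) :=
        Finset.filter_congr fun t _ =>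
          ⟨fun ht => (h'.trans ht : (openGraph ω).Reachable z t),
            fun ht => (h'.symm.trans ht : (openGraph ω).Reachable b t)⟩
      rw [heq] at h
      exact ⟨h, hzb'⟩
  have hDcB : (Rz \ D) \ B = (Rb \ D) \ B := by rw [hDc]
  -- splits: R = (R ∩ D ∩ B) + (R ∩ D \ B) + (R \ D)
  have sz1 : μ.real (Rz ∩ D) + μ.real (Rz \ D) = μ.real Rz := measureReal_inter_add_sdiff (hmeas D)
  have sb1 : μ.real (Rb ∩ D) + μ.real (Rb \ D) = μ.real Rb := measureReal_inter_add_sdiff (hmeas D)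
  have sz2 : μ.real (Rz ∩ D ∩ B) + μ.real ((Rz ∩ D) \ B) = μ.real (Rz ∩ D) :=
    measureReal_inter_add_sdiff (hmeas B)
  have sb2 : μ.real (Rb ∩ D ∩ B) + μ.real ((Rb ∩ D) \ B) = μ.real (Rb ∩ D) :=
    measureReal_inter_add_sdiff (hmeas B)
  have sz3 : μ.real ((Rz \ D) ∩ B) + μ.real ((Rz \ D) \ B) = μ.real (Rz \ D) :=
    measureReal_inter_add_sdiff (hmeas B)
  have sb3 : μ.real ((Rb \ D) ∩ B) + μ.real ((Rb \ D) \ B) = μ.real (Rb \ D) :=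
    measureReal_inter_add_sdiff (hmeas B)
  have e1 : Rz ∩ D ∩ B = D ∩ (B ∩ Rz) := by ext ω; simp only [mem_inter_iff]; tauto
  have e2 : Rb ∩ D ∩ B = D ∩ (Rb ∩ B) := by ext ω; simp only [mem_inter_iff]; tauto
  -- the target sets
  have tz : Bᶜ ∩ Rz = ((Rz ∩ D) \ B) ∪ ((Rz \ D) \ B) := by
    ext ω; simp only [mem_inter_iff, mem_compl_iff, mem_union, mem_sdiff]; tauto
  have tb : Bᶜ ∩ Rb = ((Rb ∩ D) \ B) ∪ ((Rb \ D) \ B) := by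
    ext ω; simp only [mem_inter_iff, mem_compl_iff, mem_union, mem_sdiff]; tauto
  have dz : Disjoint ((Rz ∩ D) \ B) ((Rz \ D) \ B) := by
    rw [Set.disjoint_left]; rintro ω ⟨⟨-, hD1⟩, -⟩ ⟨⟨-, hD2⟩, -⟩; exact hD2 hD1
  have db : Disjoint ((Rb ∩ D) \ B) ((Rb \ D) \ B) := by
    rw [Set.disjoint_left]; rintro ω ⟨⟨-, hD1⟩, -⟩ ⟨⟨-, hD2⟩, -⟩; exact hD2 hD1
  rw [tz, tb, measureReal_union dz (hmeas _), measureReal_union db (hmeas _), hDcB]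
  rw [e1] at sz2
  rw [e2] at sb2
  rw [hDc] at sz1
  linarith

/-- **`b` stays ahead of `z` off the observer pair.**  If `μ(R_z) ≤ μ(R_b)` then
`μ(b ↮ x, b ↮ y, R_z) ≤ μ(b ↮ x, b ↮ y, R_b)`. [cite: VandenbergHaggstromKahn2005, Thm. 1.5 (p. 7) — corollary] -/
theorem lonelier_transfer_offPair [Fintype V] (w : Sym2 V → unitInterval) (A : Finset V) (x y z b : V)
    (j : ℕ)
    (hle : (prodBernoulli w).real {ω : BondConfig V | (A.filter fun t => ω ∈ openConn z t).card ≤ j} ≤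
      (prodBernoulli w).real {ω : BondConfig V | (A.filter fun t => ω ∈ openConn b t).card ≤ j}) :
    (prodBernoulli w).real {ω : BondConfig V | ω ∉ openConn b x ∧ ω ∉ openConn b y ∧
        (A.filter fun t => ω ∈ openConn z t).card ≤ j} ≤
      (prodBernoulli w).real {ω : BondConfig V | ω ∉ openConn b x ∧ ω ∉ openConn b y ∧
        (A.filter fun t => ω ∈ openConn b t).card ≤ j} := by
  by_cases hzb : z = b
  · subst hzb; exact le_rfl
  set B : Set (BondConfig V) := openConn b x ∪ openConn b y with hBdef
  have hB : ∀ ⦃ω ω' : BondConfig V⦄, openEdgeCluster ω' z ⊆ openEdgeCluster ω z →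
      openEdgeCluster ω b ⊆ openEdgeCluster ω' b → ω ∈ B → ω' ∈ B := by
    intro ω ω' hs ht hω
    rcases hω with h | h
    · exact Or.inl (typeMinus_openConn z b x hs ht h)
    · exact Or.inr (typeMinus_openConn z b y hs ht h)
  have key := lonelier_transfer_compl w A hzb j hB hle
  have e1 : {ω : BondConfig V | ω ∉ openConn b x ∧ ω ∉ openConn b y ∧
      (A.filter fun t => ω ∈ openConn z t).card ≤ j} =
      Bᶜ ∩ {ω : BondConfig V | (A.filter fun t => ω ∈ openConn z t).card ≤ j} := by
    ext ω; simp only [hBdef, mem_inter_iff, mem_compl_iff, mem_union, mem_setOf_eq]; tauto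
  have e2 : {ω : BondConfig V | ω ∉ openConn b x ∧ ω ∉ openConn b y ∧
      (A.filter fun t => ω ∈ openConn b t).card ≤ j} =
      Bᶜ ∩ {ω : BondConfig V | (A.filter fun t => ω ∈ openConn b t).card ≤ j} := by
    ext ω; simp only [hBdef, mem_inter_iff, mem_compl_iff, mem_union, mem_setOf_eq]; tauto
  rw [e1, e2]; exact key

/-- **`b` stays ahead of `z` off the pair even when `z` is swallowed by it.**  If `μ(R_z) ≤ μ(R_b)` then
`μ(b ↮ x, b ↮ y, (z ↔ x ∨ z ↔ y), R_z) ≤ μ(b ↮ x, b ↮ y, (z ↔ x ∨ z ↔ y), R_b)`.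
[cite: VandenbergHaggstromKahn2005, Thm. 1.5 (p. 7) — corollary] -/
theorem lonelier_transfer_offPair_swallowed [Fintype V] (w : Sym2 V → unitInterval) (A : Finset V)
    (x y z b : V) (j : ℕ)
    (hle : (prodBernoulli w).real {ω : BondConfig V | (A.filter fun t => ω ∈ openConn z t).card ≤ j} ≤
      (prodBernoulli w).real {ω : BondConfig V | (A.filter fun t => ω ∈ openConn b t).card ≤ j}) :
    (prodBernoulli w).real {ω : BondConfig V | ω ∉ openConn b x ∧ ω ∉ openConn b y ∧
        (ω ∈ openConn z x ∨ ω ∈ openConn z y) ∧ (A.filter fun t => ω ∈ openConn z t).card ≤ j} ≤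
      (prodBernoulli w).real {ω : BondConfig V | ω ∉ openConn b x ∧ ω ∉ openConn b y ∧
        (ω ∈ openConn z x ∨ ω ∈ openConn z y) ∧ (A.filter fun t => ω ∈ openConn b t).card ≤ j} := by
  by_cases hzb : z = b
  · subst hzb; exact le_rfl
  -- `B = {b ∈ U} ∪ {z ∉ U}` is closed under (shrinking `C_z`, enlarging `C_b`)
  set B : Set (BondConfig V) :=
    (openConn b x ∪ openConn b y) ∪ ((openConn z x)ᶜ ∩ (openConn z y)ᶜ) with hBdef
  have hB : ∀ ⦃ω ω' : BondConfig V⦄, openEdgeCluster ω' z ⊆ openEdgeCluster ω z →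
      openEdgeCluster ω b ⊆ openEdgeCluster ω' b → ω ∈ B → ω' ∈ B := by
    intro ω ω' hs ht hω
    rcases hω with (h | h) | ⟨h1, h2⟩
    · exact Or.inl (Or.inl (typeMinus_openConn z b x hs ht h))
    · exact Or.inl (Or.inr (typeMinus_openConn z b y hs ht h))
    · exact Or.inr ⟨typeMinus_not_openConn z b x hs ht h1, typeMinus_not_openConn z b y hs ht h2⟩
  have key := lonelier_transfer_compl w A hzb j hB hle
  have e1 : {ω : BondConfig V | ω ∉ openConn b x ∧ ω ∉ openConn b y ∧
      (ω ∈ openConn z x ∨ ω ∈ openConn z y) ∧ (A.filter fun t => ω ∈ openConn z t).card ≤ j} =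
      Bᶜ ∩ {ω : BondConfig V | (A.filter fun t => ω ∈ openConn z t).card ≤ j} := by
    ext ω
    simp only [hBdef, mem_inter_iff, mem_compl_iff, mem_union, mem_setOf_eq]
    tauto
  have e2 : {ω : BondConfig V | ω ∉ openConn b x ∧ ω ∉ openConn b y ∧
      (ω ∈ openConn z x ∨ ω ∈ openConn z y) ∧ (A.filter fun t => ω ∈ openConn b t).card ≤ j} =
      Bᶜ ∩ {ω : BondConfig V | (A.filter fun t => ω ∈ openConn b t).card ≤ j} := by
    ext ω
    simp only [hBdef, mem_inter_iff, mem_compl_iff, mem_union, mem_setOf_eq]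
    tauto
  rw [e1, e2]; exact key

/-- **The swallowed part of the pair inequality.**  If `μ(R_z) ≤ μ(R_b)` then
`μ(b ↮ x, b ↮ y, (z ↔ x ∨ z ↔ y), 1 ≤ |π(x) ∪ π(y)| ≤ j) ≤ μ(b ↮ x, b ↮ y, (z ↔ x ∨ z ↔ y), R_b)`:
on the event that the comparison vertex `z` lies in `U = C(x) ∪ C(y)`, the pair champion-stability inequality for `b`
holds (because `|π(U)| ≤ j` forces `R_z` there).  The complementary part `{z ∉ U}` is the open statement (T*) of the
hull-port memo. [cite: VandenbergHaggstromKahn2005, Thm. 1.5 (p. 7) — corollary] -/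
theorem csPair_swallowed_part [Fintype V] (w : Sym2 V → unitInterval) (A : Finset V) (x y z b : V) (j : ℕ)
    (hle : (prodBernoulli w).real {ω : BondConfig V | (A.filter fun t => ω ∈ openConn z t).card ≤ j} ≤
      (prodBernoulli w).real {ω : BondConfig V | (A.filter fun t => ω ∈ openConn b t).card ≤ j}) :
    (prodBernoulli w).real {ω : BondConfig V | ω ∉ openConn b x ∧ ω ∉ openConn b y ∧
        (ω ∈ openConn z x ∨ ω ∈ openConn z y) ∧
        1 ≤ (A.filter fun t => ω ∈ openConn x t ∨ ω ∈ openConn y t).card ∧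
        (A.filter fun t => ω ∈ openConn x t ∨ ω ∈ openConn y t).card ≤ j} ≤
      (prodBernoulli w).real {ω : BondConfig V | ω ∉ openConn b x ∧ ω ∉ openConn b y ∧
        (ω ∈ openConn z x ∨ ω ∈ openConn z y) ∧ (A.filter fun t => ω ∈ openConn b t).card ≤ j} := by
  refine le_trans (measureReal_mono ?_ (measure_ne_top _ _)) (lonelier_transfer_offPair_swallowed w A x y z b j hle)
  intro ω hω
  obtain ⟨hbx, hby, hz, -, hU⟩ := hω
  refine ⟨hbx, hby, hz, le_trans (Finset.card_le_card ?_) hU⟩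
  intro t ht
  rw [Finset.mem_filter] at ht ⊢
  refine ⟨ht.1, ?_⟩
  have hzt : (openGraph ω).Reachable z t := ht.2
  rcases hz with hzx | hzy
  · have hzx' : (openGraph ω).Reachable z x := hzx
    exact Or.inl (hzx'.symm.trans hzt : (openGraph ω).Reachable x t)
  · have hzy' : (openGraph ω).Reachable z y := hzy
    exact Or.inr (hzy'.symm.trans hzt : (openGraph ω).Reachable y t)

/-- **Transfer with slack, hypothesis-free.**  For `z ≠ b` and any event `B` closed under (shrinking `C_z`,
enlarging `C_b`): `μ(Bᶜ ∩ R_z) ≤ μ(Bᶜ ∩ R_b) + max (μ(R_z) − μ(R_b)) 0`.  If `μ(R_z) ≤ μ(R_b)` this is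
`lonelier_transfer_compl`; otherwise `Bᶜ` is admissible for the pair `(b, z)` read the other way (`B` itself is closed
under (shrinking `C_b`, enlarging `C_z`) after complementation), so `μ(B ∩ R_b) ≤ μ(B ∩ R_z)`, which is the claim
rearranged.  This is the additive-slack form used for scenario averaging in the hull-port memo (§12, "TCL-slack").
[cite: VandenbergHaggstromKahn2005, Thm. 1.5 (p. 7) — corollary] -/
theorem lonelier_transfer_compl_posPart [Fintype V] (w : Sym2 V → unitInterval) (A : Finset V) {z b : V}
    (hzb : z ≠ b) (j : ℕ) {B : Set (BondConfig V)}
    (hB : ∀ ⦃ω ω' : BondConfig V⦄, openEdgeCluster ω' z ⊆ openEdgeCluster ω z →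
      openEdgeCluster ω b ⊆ openEdgeCluster ω' b → ω ∈ B → ω' ∈ B) :
    (prodBernoulli w).real (Bᶜ ∩ {ω : BondConfig V | (A.filter fun t => ω ∈ openConn z t).card ≤ j}) ≤
      (prodBernoulli w).real (Bᶜ ∩ {ω : BondConfig V | (A.filter fun t => ω ∈ openConn b t).card ≤ j}) +
        max ((prodBernoulli w).real {ω : BondConfig V | (A.filter fun t => ω ∈ openConn z t).card ≤ j} -
          (prodBernoulli w).real {ω : BondConfig V | (A.filter fun t => ω ∈ openConn b t).card ≤ j}) 0 := by
  set μ := prodBernoulli w with hμ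
  set Rz : Set (BondConfig V) := {ω | (A.filter fun t => ω ∈ openConn z t).card ≤ j} with hRz
  set Rb : Set (BondConfig V) := {ω | (A.filter fun t => ω ∈ openConn b t).card ≤ j} with hRb
  have hmeas : ∀ S : Set (BondConfig V), MeasurableSet S := fun S => (Set.toFinite S).measurableSet
  by_cases hle : μ.real Rz ≤ μ.real Rb
  · exact (lonelier_transfer_compl w A hzb j hB hle).trans (le_add_of_nonneg_right (le_max_right _ _))
  · -- here `μ(R_b) < μ(R_z)`: transfer for the pair `(b, z)` on the admissible event `B`
    have hlt : μ.real Rb ≤ μ.real Rz := (lt_of_not_ge hle).le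
    have hBc : ∀ ⦃ω ω' : BondConfig V⦄, openEdgeCluster ω' b ⊆ openEdgeCluster ω b →
        openEdgeCluster ω z ⊆ openEdgeCluster ω' z → ω ∈ Bᶜ → ω' ∈ Bᶜ := by
      intro ω ω' hb hz hω hω'
      exact hω (hB hz hb hω')
    have key := lonelier_transfer_compl w A hzb.symm j hBc hlt
    rw [compl_compl] at key
    -- `μ(R) = μ(B ∩ R) + μ(Bᶜ ∩ R)`
    have sz : μ.real (Rz ∩ B) + μ.real (Rz \ B) = μ.real Rz := measureReal_inter_add_sdiff (hmeas B)
    have sb : μ.real (Rb ∩ B) + μ.real (Rb \ B) = μ.real Rb := measureReal_inter_add_sdiff (hmeas B)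
    have e1 : Rz ∩ B = B ∩ Rz := inter_comm _ _
    have e2 : Rb ∩ B = B ∩ Rb := inter_comm _ _
    have e3 : Rz \ B = Bᶜ ∩ Rz := by ext ω; simp only [mem_sdiff, mem_inter_iff, mem_compl_iff]; tauto
    have e4 : Rb \ B = Bᶜ ∩ Rb := by ext ω; simp only [mem_sdiff, mem_inter_iff, mem_compl_iff]; tauto
    rw [e1, e3] at sz
    rw [e2, e4] at sb
    rw [max_eq_left (by linarith : (0 : ℝ) ≤ μ.real Rz - μ.real Rb)]
    change μ.real (B ∩ Rb) ≤ μ.real (B ∩ Rz) at key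
    linarith

end HullPort

end Summit.CriticalPhenomena.PercolationContinuityZ3.Theorems

end
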